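import Summits.RiemannHypothesis.RiemannHypothesis.Theorems.TiltedLandingLaw421R3LooseRecut

/-! # TiltedLandingLaw421R3F1Box — image 120 v3 «F1Box»: the far energy law with crit-1's ONE BOX BINDER (C′ verbatim), the EXCLUDED class, the CAP LAW, and the glue that prices it (C4 «kernel desk» rh-idea-6 g41; CONTINGENCY B for the Γ/rate line, director-rh g28 (CA832)(3) / (CA835)(1)(c) / (CA836)(2); DRAFT until keyed)
CAND-10 (crit-1 g7 dossier `crit-g7/cand10/CAND10.md` 77b4ade0, REPRO-2 C6 AGREE; (CA832) «CANDIDATE NEG 10» BOOKED): on instr-1's real-block frame X3 the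
registry stub F1 `RhW08.SealSwapQ.FarEnergyLawCQ (4/5)` is FALSE AS TYPED at 32 charged far levels whose lowest state is a lateral ENTRANT outside the
`RemainderBox` box (ratio .43…68 < 4/5).  Retype direction of record (CA832)(3) = crit-1's ONE-BINDER BOX C′.  ONE import (`…R3LooseRecut`, whose closure
holds `…R3RateFarC` — needed so that §3's glue is by tree names); every tree object BY NAME.
 §1  (T, OPEN) `FarEnergyLawCBoxQ c` = C′ VERBATIM: `FarEnergyLawCQ c`'s text (…R3RateFarC :26) with the binder `(∃ v, IsLowest StTrkDQ … j v ∧ |v.re − x₀| ≤ R/2 ∧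
      v.im ≤ hmax) →` inserted after `FarLevelQ … j →`; `farEnergyLawCBoxQ_of_far` (F1 ⇒ F1Box), `farEnergyLawCBoxQ_mono`.
 §2  is NOT in this image ((CA835)(1)(c), (CA843)(2)): the one-point hypothesis `|K_far(v)| ≤ η/s` at a box-lowest `v` is the level-j box read of C3
      v4b's `RhW08.FLink.RemainderBoxHereditySig` (§6, (T) OPEN, INFALL-1 pending) — a HYPOTHESIS of the F-link kernels, not typed here a second time.
 §3  THE CONSUMER GAP, typed and priced — (a) classes `FarBoxLevelQ` (ONE witness: lowest ∧ box ∧ isolated) ⊆ `FarLevelQ` and `FarExcludedQ := Far ∧ ¬FarBox`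
      (the X3 levels); `energyLawOn_farBox_of_CBox : FarEnergyLawCBoxQ c → EnergyLawOnQ FarBoxLevelQ c`; (b) ★ THE CAP LAW (T, OPEN; NAME OF RECORD
      (CA836)(2); C3 v4b does not cite it — F1 side only): COUNT form `FarExcludedCapQ θ := CountLawQ FarExcludedQ (capBudgetQ θ)` («#{charged excluded far levels up to every charged
      horizon} ≤ θ·P», P = `typedPurse`), COST form `FarExcludedCostCapQ θ := ClassLawQ FarExcludedQ (capBudgetQ θ)` (what the books consume; COUNT ∧
      `NoRiseOnQ FarExcludedQ` ⇒ COST by the tree's `classLawQ_of_countLaw`), ∃-form `FarExcludedCapLtQ θ₀` (checklist (iv)); (c) ★★ THE GLUE replacing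
      `rateLawsHalfQ_of_canonical`'s role, PROVED: `restRateBotPQ_half_of_boxBooks : FarEnergyLawCBoxQ (4/5) → EnergyRiseLawQ aR → ConsLawQ aC →
      FarExcludedCostCapQ θ → ApproachAllowanceQ (approachBudgetBoxQ aR aC θ) → RestRateBotPQ halfPurse`, `law421R_of_boxBooks : TopPinning →
      RegUmbrella11S → … → TiltedLandingLaw421R` — v11q's six stubs with F1 ↦ F1Box, ONE new stub (the cap), ★A's allowance TIGHTENED by exactly the cap
      (`approachBudgetBoxQ aR aC θ = approachBudgetHalfQ aR aC − θ·P`; `approachBudgetBoxQ_zero`); the books see the far class as `FarBox ∪ Excluded ≡ Far`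
      (`classLawQ_union`), so `Cons ∖ Far` and ★A's `Approach` keep their REGISTRY LITERALS — only the allowance moves.
HONEST READING.  (a) The price of the Γ-line repair is now ONE number per frame: θ·P must come out of ★A's margin (instr-1 E15: n_excl ≤ .037·P measured on the
27 real-block frames; crit-1: analytic cap ≲ .10–.15·P UNCERTIFIED — the cap law's own open item); the capital identity at the ½ purse has no other slack.
(b) Nothing here is a law being claimed: F1Box, the cap, F2, C, ★A_θ, TopPinning, RegUmbrella11S are typed OPEN hypotheses; the theorems are bookkeeping.
(c) Registry v11q UNCHANGED; a certified dossier is not a Lean refutation; this file prices (H2) for the human, it claims nothing.  Sorry-free; typer-lint clean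
(no type-class declarations, no custom syntax, no hidden declarations, no option changes).  RH is NOT proved; ⟨33346⟩/⟨33347⟩ OPEN; checked ≠ landed ≠ proved. -/

noncomputable section

namespace RhW08.F1Box

open Complex
open scoped ComplexConjugate
open RhW08.Round1 RhW08.StSwap RhW08.Round2 RhW08.QuadW
open RhW08.SealSwap (PBot)
open RhW08.SealSwapQ RhW08.RateSplit RhW08.BurgersRate RhW08.BurgersRateG3
open RhIdea6.G17.W07C7 RhIdea6.G17.W07C7.Rev6 RhIdea6.G18.W07C8.Law421BirthS RhIdea6.G19.W07C11.Seam
open RhIdea6.G20.W07C12.Frac RhIdea6.G20.W07C12.StColP RhW07.C12.FieldSplit RhIdea6.G21.W07C13.TentMax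
open RhW07.C14.TwoSided RhW07.C14.Classes RhW07.C14.Lineage RhW07.C14.Booking
open RhW08.PurseP RhW08.LooseRecut

/-! ## §1 the far energy law with the ONE BOX BINDER (C′ verbatim) -/

/-- (T, OPEN) §1 **THE BOX-BINDERED FAR ENERGY LAW** C′ (crit-1 CAND-10; director (CA832)(3) verbatim): `FarEnergyLawCQ c` restricted to the charged far
levels with SOME lowest band state inside the `RemainderBox` box `|Re v − x₀| ≤ R/2 ∧ Im v ≤ hmax`. -/
def FarEnergyLawCBoxQ (c : ℝ) : Prop :=
  ∀ (η : ℝ) (f : ℂ → ℂ) (x₀ s hmax R Hs : ℝ) (B : ℕ), EngineHyps5 2 η f x₀ s hmax R Hs B →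
    ∀ j : ℕ, Charged (PTrkSQ PBot) StTrkDQ ReadyR2 η f x₀ s hmax R Hs B j → FarLevelQ η f x₀ s hmax R Hs B j →
      (∃ v : ℂ, IsLowest StTrkDQ η f x₀ s hmax R Hs B j v ∧ |v.re - x₀| ≤ R / 2 ∧ v.im ≤ hmax) →
      c * s ^ 2 ≤ η ^ 2 * (lowH StTrkDQ η f x₀ s hmax R Hs B j ^ 2 - lowH StTrkDQ η f x₀ s hmax R Hs B (j + 1) ^ 2)

/-- (K) §1 F1 ⇒ F1Box (drop the binder). -/
theorem farEnergyLawCBoxQ_of_far {c : ℝ} (h : FarEnergyLawCQ c) : FarEnergyLawCBoxQ c :=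
  fun η f x₀ s hmax R Hs B hE j hch hfar _ => h η f x₀ s hmax R Hs B hE j hch hfar

/-- (K) §1 the law is monotone in the constant. -/
theorem farEnergyLawCBoxQ_mono {c c' : ℝ} (hcc : c' ≤ c) (h : FarEnergyLawCBoxQ c) : FarEnergyLawCBoxQ c' := by
  intro η f x₀ s hmax R Hs B hE j hch hfar hbox
  have := h η f x₀ s hmax R Hs B hE j hch hfar hbox
  nlinarith [sq_nonneg s]

/-! ## §3 (a) the BOX-FAR class and the EXCLUDED class -/

/-- §3 **BOX-FAR level** (ONE witness): some lowest band state `v` of level `j` lies in the box AND sees no zero of `f⁽ʲ⁾` other than `v, v̄` in `|Re z − Re v| < R/2`. -/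
def FarBoxLevelQ : LevelClass := fun η f x₀ s hmax R Hs B j =>
  ∃ v : ℂ, IsLowest StTrkDQ η f x₀ s hmax R Hs B j v ∧ (|v.re - x₀| ≤ R / 2 ∧ v.im ≤ hmax) ∧
    ∀ z : ℂ, iteratedDeriv j f z = 0 → |z.re - v.re| < R / 2 → z = v ∨ z = conj v

/-- §3 **THE EXCLUDED class**: far, but not box-far («charged far levels whose lowest is outside the box» — X3's 32 entrant levels). -/
def FarExcludedQ : LevelClass := fun η f x₀ s hmax R Hs B j => FarLevelQ η f x₀ s hmax R Hs B j ∧ ¬ FarBoxLevelQ η f x₀ s hmax R Hs B j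

/-- (K) §3 box-far ⇒ far. -/
theorem farLevelQ_of_farBox {η : ℝ} {f : ℂ → ℂ} {x₀ s hmax R Hs : ℝ} {B j : ℕ} (h : FarBoxLevelQ η f x₀ s hmax R Hs B j) :
    FarLevelQ η f x₀ s hmax R Hs B j := by
  obtain ⟨v, hlow, -, hiso⟩ := h
  exact ⟨v, hlow, hiso⟩

/-- (K) §3 the far class is `FarBox ∪ Excluded`, pointwise. -/
theorem farBox_union_excluded_iff (η : ℝ) (f : ℂ → ℂ) (x₀ s hmax R Hs : ℝ) (B j : ℕ) :
    unionClass FarBoxLevelQ FarExcludedQ η f x₀ s hmax R Hs B j ↔ FarLevelQ η f x₀ s hmax R Hs B j := by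
  simp only [unionClass, FarExcludedQ]
  constructor
  · rintro (h | h)
    · exact farLevelQ_of_farBox h
    · exact h.1
  · intro h
    by_cases hb : FarBoxLevelQ η f x₀ s hmax R Hs B j
    · exact Or.inl hb
    · exact Or.inr ⟨h, hb⟩

/-- (K) §3 `Excluded ∖ FarBox = Excluded`, pointwise. -/
theorem excluded_diff_farBox_iff (η : ℝ) (f : ℂ → ℂ) (x₀ s hmax R Hs : ℝ) (B j : ℕ) :
    diffClass FarExcludedQ FarBoxLevelQ η f x₀ s hmax R Hs B j ↔ FarExcludedQ η f x₀ s hmax R Hs B j := by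
  simp only [diffClass, FarExcludedQ]
  tauto

/-- ★ (K) §3 **C′ ⇒ the class law of record**: F1Box gives LooseRecut's generic energy law on the box-far class (the ONE witness serves both binders). -/
theorem energyLawOn_farBox_of_CBox {c : ℝ} (h : FarEnergyLawCBoxQ c) : EnergyLawOnQ FarBoxLevelQ c := by
  intro η f x₀ s hmax R Hs B hE j hch hfar
  obtain ⟨v, hlow, hbox, hiso⟩ := hfar
  exact h η f x₀ s hmax R Hs B hE j hch ⟨v, hlow, hiso⟩ ⟨v, hlow, hbox⟩

/-! ## §3 (b) ★ THE CAP LAW (the ONE open item of the box retype) -/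

/-- §3 the cap budget `θ·P`, `P = typedPurse = 4·hmax/s + (Hs/s)² + B + 1`. -/
def capBudgetQ (θ : ℝ) : Budget := fun _η f x₀ s hmax R Hs B => θ * typedPurse f x₀ s hmax R Hs B

/-- ★ (T, OPEN) §3 **THE CAP LAW, COUNT form** (director (CA832)(3) wording; C3 v4 cites THIS name): at every charged horizon of a legal frame the NUMBER of
charged excluded far levels so far is at most `θ·P`.  instr-1 E15: `≤ .037·P` on 27 real-block frames; crit-1: analytic cap ≲ .10–.15·P, UNCERTIFIED. -/
def FarExcludedCapQ (θ : ℝ) : Prop := CountLawQ FarExcludedQ (capBudgetQ θ)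

/-- ★ (T, OPEN) §3 **THE CAP LAW, COST form** (what the books consume): the NET COST `Σ (1 − 4·dropQ/s)` of the charged excluded far levels is at most `θ·P`. -/
def FarExcludedCostCapQ (θ : ℝ) : Prop := ClassLawQ FarExcludedQ (capBudgetQ θ)

/-- (T, OPEN) §3 the ∃-form (crux-typing checklist (iv)): some cap strictly below `θ₀` holds. -/
def FarExcludedCapLtQ (θ₀ : ℝ) : Prop := ∃ θ : ℝ, θ < θ₀ ∧ FarExcludedCostCapQ θ

/-- (K) §3 COUNT ∧ no-rise on the excluded class ⇒ COST (tree `classLawQ_of_countLaw`). -/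
theorem farExcludedCostCapQ_of_count {θ : ℝ} (hc : FarExcludedCapQ θ) (hr : NoRiseOnQ FarExcludedQ) : FarExcludedCostCapQ θ :=
  classLawQ_of_countLaw hc hr

/-- (K) §3 the cost cap is monotone in `θ` (on legal frames `0 ≤ P`). -/
theorem farExcludedCostCapQ_mono {θ θ' : ℝ} (hθ : θ ≤ θ') (h : FarExcludedCostCapQ θ) : FarExcludedCostCapQ θ' := by
  intro η f x₀ s hmax R Hs B hE k hk
  refine (h η f x₀ s hmax R Hs B hE k hk).trans ?_
  have hs : 0 < s := hE.2.2.2.1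
  have hP : 0 ≤ typedPurse f x₀ s hmax R Hs B := by
    have h1 : 0 ≤ 4 * hmax / s := div_nonneg (by linarith [hE.2.2.2.2.1]) hs.le
    simp only [typedPurse]
    positivity
  exact mul_le_mul_of_nonneg_right hθ hP

/-! ## §3 (c) ★★ THE GLUE that prices the cap: books with far class `FarBox ∪ Excluded ≡ Far` -/

/-- (K) §3 a class law on the box-far class and the cost cap give a class law on the WHOLE far class with the summed allowance. -/
theorem classLawQ_far_of_box_cap {aF : Budget} {θ : ℝ} (hF : ClassLawQ FarBoxLevelQ aF) (hX : FarExcludedCostCapQ θ) :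
    ClassLawQ FarLevelQ (addBudget aF (capBudgetQ θ)) :=
  classLawQ_congr (farBox_union_excluded_iff) (classLawQ_union hF (classLawQ_congr (fun η f x₀ s hmax R Hs B j =>
    (excluded_diff_farBox_iff η f x₀ s hmax R Hs B j).symm) hX))

/-- §3 ★A's allowance TIGHTENED by the cap: `approachBudgetHalfQ aR aC − θ·P`. -/
def approachBudgetBoxQ (aR aC : Budget) (θ : ℝ) : Budget := fun η f x₀ s hmax R Hs B =>
  approachBudgetHalfQ aR aC η f x₀ s hmax R Hs B - θ * typedPurse f x₀ s hmax R Hs B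

/-- (K) §3 at `θ = 0` it is ★A's registry literal. -/
theorem approachBudgetBoxQ_zero (aR aC : Budget) : approachBudgetBoxQ aR aC 0 = approachBudgetHalfQ aR aC := by
  funext η f x₀ s hmax R Hs B
  simp [approachBudgetBoxQ]

/-- (K) §3 CAPITAL at the ½ purse with the cap moved from ★A to the far purse (`capitalLawPQ_half_recut`, exact). -/
theorem capitalLawPQ_half_box (aR aC : Budget) (θ : ℝ) :
    CapitalLawPQ halfPurse (addBudget (addBudget (scaleBudgetQ (4 / 5)⁻¹ energyPurseQ) (scaleBudgetQ (4 / 5)⁻¹ aR)) (capBudgetQ θ)) aC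
      (approachBudgetBoxQ aR aC θ) := by
  intro η f x₀ s hmax R Hs B hE
  have h := capitalLawPQ_half_recut aR aC η f x₀ s hmax R Hs B hE
  simp only [addBudget, capBudgetQ, approachBudgetBoxQ] at h ⊢
  linarith

/-- ★★ (K) §3 **THE BOX RATE DOOR at the ½ purse**: F1Box (4/5) + F2 + C (registry literal class `Cons ∖ Far`) + the COST CAP + ★A on its registry class
`Approach` at the TIGHTENED allowance ⟹ `RestRateBotPQ halfPurse`. -/
theorem restRateBotPQ_half_of_boxBooks {aR aC : Budget} {θ : ℝ} (hF1 : FarEnergyLawCBoxQ (4 / 5)) (hr : EnergyRiseLawQ aR) (hC : ConsLawQ aC)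
    (hX : FarExcludedCostCapQ θ) (hA : ApproachAllowanceQ (approachBudgetBoxQ aR aC θ)) : RestRateBotPQ halfPurse :=
  restRateBotPQ_of_threeBooks_ge (𝓕 := FarLevelQ) (𝓒 := ConsLevelQ) hP_half
    (classLawQ_far_of_box_cap (classLawQ_of_energyLawOn_rises (by norm_num) (energyLawOn_farBox_of_CBox hF1) hr) hX) hC hA
    (capitalLawPQ_half_box aR aC θ)

/-- (K) §3 … from the ∃-form below `θ₀` with ★A at `θ₀` (★A is antitone in the cap). -/
theorem restRateBotPQ_half_of_boxBooks_lt {aR aC : Budget} {θ₀ : ℝ} (hF1 : FarEnergyLawCBoxQ (4 / 5)) (hr : EnergyRiseLawQ aR) (hC : ConsLawQ aC)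
    (hX : FarExcludedCapLtQ θ₀) (hA : ApproachAllowanceQ (approachBudgetBoxQ aR aC θ₀)) : RestRateBotPQ halfPurse := by
  obtain ⟨θ, hθ, hXθ⟩ := hX
  refine restRateBotPQ_half_of_boxBooks hF1 hr hC hXθ (RhW08.TouchedGlueW.classLawQ_mono hA fun η f x₀ s hmax R Hs B hE => ?_)
  have hs : 0 < s := hE.2.2.2.1
  have hP : 0 ≤ typedPurse f x₀ s hmax R Hs B := by
    have h1 : 0 ≤ 4 * hmax / s := div_nonneg (by linarith [hE.2.2.2.2.1]) hs.le
    simp only [typedPurse]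
    positivity
  simp only [approachBudgetBoxQ]
  nlinarith

/-- ★★ (K) §3 **THE CRUX BY NAME from the box stub set** (v11q's composition with F1 ↦ F1Box, + the cap, ★A tightened): TopPinning + RegUmbrella11S + F1Box +
F2c + Cc + COST CAP θ + ★A_θ ⟹ `TiltedLandingLaw421R`.  A CONDITIONAL composition; it credits nothing by itself. -/
theorem law421R_of_boxBooks {θ : ℝ} (hP : RhW08.Lens1Pinning.TopPinning) (hU : RhW08.Lens1Pinning.RegUmbrella11S)
    (hF1 : FarEnergyLawCBoxQ (4 / 5)) (hF2 : EnergyRiseLawQ riseSupQ) (hC : ConsLawQ consSupQ) (hX : FarExcludedCostCapQ θ)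
    (hA : ApproachAllowanceQ (approachBudgetBoxQ riseSupQ consSupQ θ)) :
    Summit.RiemannHypothesis.RiemannHypothesis.Theses.EarlyAppointments.TiltedLandingLaw421R :=
  law421Half_of_succ_rate
    (RhW08.Lens1Coverage.restSuccBotQ_of_resS
      (RhW08.Lens1Coverage.regRes8S_of_regHungCut10S (RhW08.Lens1Pinning.regHungCut10S_of_topPinning hP hU)))
    (restRateBotPQ_half_of_boxBooks hF1 hF2 hC hX hA)

/-- (K) §3 idem from the COUNT cap + no-rise on the excluded class (director's wording end to end). -/
theorem law421R_of_boxBooks_count {θ : ℝ} (hP : RhW08.Lens1Pinning.TopPinning) (hU : RhW08.Lens1Pinning.RegUmbrella11S)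
    (hF1 : FarEnergyLawCBoxQ (4 / 5)) (hF2 : EnergyRiseLawQ riseSupQ) (hC : ConsLawQ consSupQ) (hX : FarExcludedCapQ θ) (hN : NoRiseOnQ FarExcludedQ)
    (hA : ApproachAllowanceQ (approachBudgetBoxQ riseSupQ consSupQ θ)) :
    Summit.RiemannHypothesis.RiemannHypothesis.Theses.EarlyAppointments.TiltedLandingLaw421R :=
  law421R_of_boxBooks hP hU hF1 hF2 hC (farExcludedCostCapQ_of_count hX hN) hA

end RhW08.F1Box
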